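import Literature.MathematicalPhysics.QuantumFieldTheory.Balaban1983to89.T3Thm1CarrierNative
import HarnessLib

/-!
# Route `UnitScaleTilt`, crux K1 child «MinimiserStabilityRegPr» (stmt-QuantumFields-19200) — the V2 line of OWNER RULING g20-№2 (B):
# **Proposition 8 at the `T³` carriers ⇐ the ONE-STEP HALVING of [Balaban1985Variational] Sect. F, in the registered stub's shape**

Cell `ym3-torus` (HUMAN RULING D-0037, YM ladder rung R3), seat `ym3-torus-p1` gen 14 (UV side); memo HOME/UV3-NODE.md §23.

WHAT THIS FILE IS.  The registered stub V2 of skeleton v6 (636b1fa3b005b89b) reads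
`stub_prop8 : ∀ L, 1 < L → ∃ B₃, 4 < B₃ ∧ B11.Prop8Printed B₃ (famX L)` ([Balaban1985Variational] Prop. 8 p. 304 at the d = 3 carriers).
Print proves Prop. 8 by the HALVING STEP of Sect. F iterated (p. 304: *«hence U_k belongs to the space (2) with max{B₃ε₁, ½ε₀} instead of
ε₀. If ½ε₀ ≦ B₃ε₁, then the required regularity is proved. If ½ε₀ > B₃ε₁, then we apply again the whole reasoning with ½ε₀ instead of ε₀.
We continue this way until we reach the bound B₃ε₁.»*).  The iteration itself is ALREADY kernel-checked in the tree — lit-balaban's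
`B11Prop8Assembly.prop8Printed_of_halvingStep` (abstract carrier, hypothesis structure `B11Prop8Assembly.HalvingStep P B₃ a₅`) and, at the
`T³` carrier in native form, `T3Thm1CarrierNative.prop8Printed_famX_of_halvingNative` (schema `HalvingNativeAt L a₅ B₃`).  This file is the
BY-NAME GLUE in the stub's `∀ L, 1 < L → ∃ B₃, 4 < B₃ ∧ …` shape, so that skeleton v7 can replace `stub_prop8` by the one-step stub
`stub_halvingStep` (owner ruling g20-№2 (B1): «same binders as `Prop8Printed`, conclusion halved») and discharge V2 by `prop8_of_halvingLiteral`: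
§1 the three readings of the one-step statement at `famX L` — LITERAL (Prop8Printed's binders, conclusion `InU (max (B₃ε₁) (ε₀/2)) U`),
DICTIONARY (`∀ i, HalvingStep (famX L i) B₃ a₅`) and NATIVE (`HalvingNativeAt L a₅ B₃`) — are the same statement (`Iff`s by unfolding);
§2 the native statement follows from its MINIMISER form («a minimiser of the Wilson action over (6)(ε₀), `0 < ε₀ ≤ a₅`, over a (7)-datum lies
in `𝔘_k(max{B₃ε₁, ½ε₀})`»): a reading-R2-critical `U ∈ 𝔘_k(ε₀)` minimises over (6) at the radius `min{e, ε₀}` and the spaces (2) are monotone;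
§3 the `∀ L ∃ B₃ > 4` glue theorems `prop8_of_halvingLiteral` / `prop8_of_halvingStep` / `prop8_of_halvingNative` / `prop8_of_halvingMinimisers`.
No definition, no sorry, standard axioms; `--supports stmt-QuantumFields-19200`.  NOT a claim about the mass gap; the one-step estimate
(Sect. F (144)–(168): [Balaban1985RegularSpaces] Thm 2 gauge, the flat constrained propagators of [Balaban1984PropagatorsII] (2.47)–(2.51),
the datum bound (160)) is NOT proved here — it is the content of the v7 stub.

References: T. Bałaban, Commun. Math. Phys. **102** (1985) 277–309 [Balaban1985Variational], Prop. 8 and the halving passage p. 304,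
spaces (2), (6), (8) p. 278.
-/

set_option autoImplicit false

noncomputable section

open scoped Matrix.Norms.L2Operator
open Literature.MathematicalPhysics.QuantumFieldTheory.Balaban1983to89
open Literature.MathematicalPhysics.QuantumFieldTheory.Balaban1983to89.T3ContinuumYM3Torus
open Literature.MathematicalPhysics.QuantumFieldTheory.Balaban1983to89.T3UnitLawDensityEML (ℰp)
open Literature.MathematicalPhysics.QuantumFieldTheory.Balaban1983to89.T3DescentFibreTower
open Literature.MathematicalPhysics.QuantumFieldTheory.Balaban1983to89.T3RegularMinimiser
open Literature.MathematicalPhysics.QuantumFieldTheory.Balaban1983to89.T3PrintedRegularMinimiser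
open Literature.MathematicalPhysics.QuantumFieldTheory.Balaban1983to89.T3PrintedMinimiserExistence
open Literature.MathematicalPhysics.QuantumFieldTheory.Balaban1983to89.T3Thm1Carrier
open Literature.MathematicalPhysics.QuantumFieldTheory.Balaban1983to89.T3Thm1CarrierNative
open Literature.MathematicalPhysics.QuantumFieldTheory.Balaban1983to89.B11 (Prop8Printed)
open Literature.MathematicalPhysics.QuantumFieldTheory.Balaban1983to89.B11Prop8Assembly (HalvingStep)

namespace Summit.QuantumFields.YangMills.Theorems.Prop8Iter

/-! ## §1 The one-step halving statement at `famX L`: literal, dictionary and native readings coincide -/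

/-- **LITERAL ↔ DICTIONARY**: at block size `L`, constants `B₃, a₅`, the one-step statement written with `Prop8Printed`'s binders and the halved
conclusion `InU (max (B₃ε₁) (ε₀/2)) U` IS lit-balaban's located hypothesis `HalvingStep (famX L i) B₃ a₅` at every member (re-ordering of two
binders). [cite: Balaban1985Variational, Sect. F p.304 before Prop. 8] -/
theorem halvingLiteral_iff_halvingStep {L : ℕ} {B₃ a₅ : ℝ} :
    (∀ (i : Idx L) (ε₀ ε₁ : ℝ), 0 < ε₁ → ∀ (V : (famX L i).Bdry) (U : (famX L i).Cfg), (famX L i).Reg7 ε₁ V → (famX L i).InU ε₀ U →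
        (famX L i).InB V U → (famX L i).IsCritical V U → ε₀ ≤ a₅ → (famX L i).InU (max (B₃ * ε₁) (ε₀ / 2)) U) ↔
      ∀ i : Idx L, HalvingStep (famX L i) B₃ a₅ :=
  ⟨fun H i => ⟨fun ε₀ ε₁ V U hε₁ hV hU hB hcrit hε₀ => H i ε₀ ε₁ hε₁ V U hV hU hB hcrit hε₀⟩,
    fun H i ε₀ ε₁ hε₁ V U hV hU hB hcrit hε₀ => (H i).step ε₀ ε₁ V U hε₁ hV hU hB hcrit hε₀⟩

/-- **LITERAL ↔ NATIVE**: the same one-step statement IS `HalvingNativeAt L a₅ B₃` — for `F.L = L`, `n < K`, `0 < ε₁`, `ε₀ ≦ a₅`, a (7)-datum `V`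
(`PlaqSmall ε₁ V`), `U ∈ 𝔘_k(ε₀)` (`RegPr`) in the (0.4)-fibre of `V`, critical in reading R2 ⇒ `RegPr F n K (max (B₃ε₁) (ε₀/2)) U`
(through `T3Thm1CarrierNative.halvingStep_famX_iff_native`). [cite: Balaban1985Variational, Sect. F p.304 before Prop. 8] -/
theorem halvingLiteral_iff_native {L : ℕ} {B₃ a₅ : ℝ} :
    (∀ (i : Idx L) (ε₀ ε₁ : ℝ), 0 < ε₁ → ∀ (V : (famX L i).Bdry) (U : (famX L i).Cfg), (famX L i).Reg7 ε₁ V → (famX L i).InU ε₀ U →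
        (famX L i).InB V U → (famX L i).IsCritical V U → ε₀ ≤ a₅ → (famX L i).InU (max (B₃ * ε₁) (ε₀ / 2)) U) ↔
      HalvingNativeAt L a₅ B₃ :=
  halvingLiteral_iff_halvingStep.trans halvingStep_famX_iff_native

/-! ## §2 The native one-step statement from its minimiser form -/

/-- Membership in print's space (2) at the carrier forces `0 < ε₀` (the finest torus has a plaquette and `|U(∂p) − 1| ≥ 0`; bookkeeping).
[cite: Balaban1985Variational, (2) p.278] -/
theorem eps_pos_of_regPr {F : T3Family} {n K : ℕ} {ε₀ : ℝ} {U : GaugeField (F.P K) 0 (Matrix.specialUnitaryGroup (Fin 2) ℂ)}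
    (h : RegPr F n K ε₀ U) : 0 < ε₀ := by
  let p : Plaq (F.P K) 0 := ⟨default, ⟨0, by simp⟩, ⟨1, by simp⟩, Fin.mk_lt_mk.mpr Nat.zero_lt_one⟩
  have h1 : (0 : ℝ) < regThreshold F n K ε₀ := (GaugeGroup.dist1_nonneg _).trans_lt (h.1 p)
  by_contra he
  refine absurd h1 (not_lt.mpr ?_)
  unfold regThreshold
  exact mul_nonpos_of_nonpos_of_nonneg (not_lt.mp he) (by positivity)

/-- **THE ONE-STEP HALVING ⇐ ITS MINIMISER FORM.**  Suppose that for every member `F` (`F.L = L`), heights `n < K`, `0 < ε₁`, `0 < ε₀ ≦ a₅`,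
every (7)-datum `V` and every MINIMISER `U` of the Wilson action over print's space (6)(ε₀) = `regFibrePr F n K _ ε₀ V` one has
`U ∈ 𝔘_k(max{B₃ε₁, ½ε₀})`.  Then `HalvingNativeAt L a₅ B₃`: a reading-R2-critical `U ∈ 𝔘_k(ε₀) ∩ 𝔅_k(V)` minimises over (6) at SOME radius
`e > 0`, hence over (6)(`min{e, ε₀}`) (it lies there; (6) is monotone in the radius, `regFibrePr_mono`), the minimiser form applies at
`min{e, ε₀} ≦ a₅`, and `max{B₃ε₁, ½min{e, ε₀}} ≦ max{B₃ε₁, ½ε₀}` with (2) monotone (`regPr_mono`).  So a prover of the v7 stub may work with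
minimisers over (6)(ε₀) only. [cite: Balaban1985Variational, Sect. F p.300 «critical configurations … in the spaces (6)», p.304] -/
theorem halvingNative_of_minimisers {L : ℕ} {a₅ B₃ : ℝ}
    (H : ∀ F : T3Family, F.L = L → ∀ (n K : ℕ) (hnK : n < K) (ε₀ ε₁ : ℝ), 0 < ε₁ → 0 < ε₀ → ε₀ ≤ a₅ →
      ∀ V : GaugeField (F.P n) 0 (Matrix.specialUnitaryGroup (Fin 2) ℂ), PlaqSmall ε₁ V →
        ∀ U ∈ regFibrePr F n K hnK.le ε₀ V,
          IsMinOn (fun W : GaugeField (F.P K) 0 (Matrix.specialUnitaryGroup (Fin 2) ℂ) => wilsonAction4 W) (regFibrePr F n K hnK.le ε₀ V) U →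
            RegPr F n K (max (B₃ * ε₁) (ε₀ / 2)) U) :
    HalvingNativeAt L a₅ B₃ := by
  intro F hF n K hnK ε₀ ε₁ hε₁ hε₀ V U hV hU hB hcrit
  obtain ⟨e, he, hUe, hmin⟩ := hcrit
  have hε₀pos : 0 < ε₀ := eps_pos_of_regPr hU
  have hr : 0 < min e ε₀ := lt_min he hε₀pos
  -- `U` lies in (6) at the radius `min{e, ε₀}` and minimises there
  have hUr : U ∈ regFibrePr F n K hnK.le (min e ε₀) V := by
    rcases min_choice e ε₀ with hmn | hmn <;> rw [hmn]
    · exact hUe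
    · exact (mem_regFibrePr_iff F).mpr ⟨hB, hU⟩
  have hminr : IsMinOn (fun W : GaugeField (F.P K) 0 (Matrix.specialUnitaryGroup (Fin 2) ℂ) => wilsonAction4 W)
      (regFibrePr F n K hnK.le (min e ε₀) V) U :=
    hmin.on_subset (regFibrePr_mono F (min_le_left e ε₀) V)
  have hstep := H F hF n K hnK (min e ε₀) ε₁ hε₁ hr ((min_le_right e ε₀).trans hε₀) V hV U hUr hminr
  refine regPr_mono F (max_le_max le_rfl ?_) hstep
  exact div_le_div_of_nonneg_right (min_le_right e ε₀) (by norm_num)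

/-! ## §3 The glue theorems in the stub's `∀ L, 1 < L → ∃ B₃, 4 < B₃ ∧ …` shape -/

/-- **V2 ⇐ THE ONE-STEP HALVING, LITERAL SHAPE** (the `landed_…` line of skeleton v7): if for every block size `L > 1` there are `B₃ > 4` and
`a₅ > 0` such that every critical (reading R2) `U ∈ 𝔘_k(ε₀) ∩ 𝔅_k(V)` over a (7)-datum with `ε₀ ≦ a₅` lies in `𝔘_k(max{B₃ε₁, ½ε₀})` — the
registered stub V2's binders with the conclusion halved — then V2 itself: `∀ L, 1 < L → ∃ B₃, 4 < B₃ ∧ Prop8Printed B₃ (famX L)`, with the SAME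
`B₃` (and the same `a₅`), by lit-balaban's kernel-checked iteration `B11Prop8Assembly.prop8Printed_of_halvingStep` («We continue this way until
we reach the bound B₃ε₁») and the monotonicity of (2) at the carrier (`T3Thm1CarrierNative.inU_famX_mono`). [cite: Balaban1985Variational, Prop. 8 p.304] -/
theorem prop8_of_halvingLiteral
    (H : ∀ L : ℕ, 1 < L → ∃ B₃ : ℝ, 4 < B₃ ∧ ∃ a₅ : ℝ, 0 < a₅ ∧
      ∀ (i : Idx L) (ε₀ ε₁ : ℝ), 0 < ε₁ → ∀ (V : (famX L i).Bdry) (U : (famX L i).Cfg), (famX L i).Reg7 ε₁ V → (famX L i).InU ε₀ U →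
        (famX L i).InB V U → (famX L i).IsCritical V U → ε₀ ≤ a₅ → (famX L i).InU (max (B₃ * ε₁) (ε₀ / 2)) U) :
    ∀ L : ℕ, 1 < L → ∃ B₃ : ℝ, 4 < B₃ ∧ Prop8Printed B₃ (famX L) := by
  intro L hL
  obtain ⟨B₃, hB₃, a₅, ha₅, h⟩ := H L hL
  exact ⟨B₃, hB₃, B11Prop8Assembly.prop8Printed_of_halvingStep (famX L) (by linarith) ha₅
    (fun i e e' U he hU => inU_famX_mono i e e' U he hU) (halvingLiteral_iff_halvingStep.mp h)⟩

/-- **V2 ⇐ THE ONE-STEP HALVING, DICTIONARY SHAPE** (`∃ a₅ > 0, ∀ i, HalvingStep (famX L i) B₃ a₅` per `L`, same `B₃`).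
[cite: Balaban1985Variational, Prop. 8 p.304] -/
theorem prop8_of_halvingStep
    (H : ∀ L : ℕ, 1 < L → ∃ B₃ : ℝ, 4 < B₃ ∧ ∃ a₅ : ℝ, 0 < a₅ ∧ ∀ i : Idx L, HalvingStep (famX L i) B₃ a₅) :
    ∀ L : ℕ, 1 < L → ∃ B₃ : ℝ, 4 < B₃ ∧ Prop8Printed B₃ (famX L) := by
  refine prop8_of_halvingLiteral fun L hL => ?_
  obtain ⟨B₃, hB₃, a₅, ha₅, h⟩ := H L hL
  exact ⟨B₃, hB₃, a₅, ha₅, halvingLiteral_iff_halvingStep.mpr h⟩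

/-- **V2 ⇐ THE ONE-STEP HALVING, NATIVE SHAPE** (`∃ a₅ > 0, HalvingNativeAt L a₅ B₃` per `L`, same `B₃`; = `prop8Printed_famX_of_halvingNative`
member by member). [cite: Balaban1985Variational, Prop. 8 p.304] -/
theorem prop8_of_halvingNative
    (H : ∀ L : ℕ, 1 < L → ∃ B₃ : ℝ, 4 < B₃ ∧ ∃ a₅ : ℝ, 0 < a₅ ∧ HalvingNativeAt L a₅ B₃) :
    ∀ L : ℕ, 1 < L → ∃ B₃ : ℝ, 4 < B₃ ∧ Prop8Printed B₃ (famX L) := by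
  refine prop8_of_halvingLiteral fun L hL => ?_
  obtain ⟨B₃, hB₃, a₅, ha₅, h⟩ := H L hL
  exact ⟨B₃, hB₃, a₅, ha₅, halvingLiteral_iff_native.mpr h⟩

/-- **V2 ⇐ THE ONE-STEP HALVING FOR MINIMISERS** (the form a prover of the v7 stub actually works in): if for every `L > 1` there are `B₃ > 4`,
`a₅ > 0` such that every minimiser of the Wilson action over (6)(ε₀), `0 < ε₀ ≦ a₅`, over a (7)-datum with `0 < ε₁` lies in
`𝔘_k(max{B₃ε₁, ½ε₀})`, then `∀ L, 1 < L → ∃ B₃, 4 < B₃ ∧ Prop8Printed B₃ (famX L)` (same `B₃`). [cite: Balaban1985Variational, Prop. 8 p.304] -/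
theorem prop8_of_halvingMinimisers
    (H : ∀ L : ℕ, 1 < L → ∃ B₃ : ℝ, 4 < B₃ ∧ ∃ a₅ : ℝ, 0 < a₅ ∧
      ∀ F : T3Family, F.L = L → ∀ (n K : ℕ) (hnK : n < K) (ε₀ ε₁ : ℝ), 0 < ε₁ → 0 < ε₀ → ε₀ ≤ a₅ →
        ∀ V : GaugeField (F.P n) 0 (Matrix.specialUnitaryGroup (Fin 2) ℂ), PlaqSmall ε₁ V →
          ∀ U ∈ regFibrePr F n K hnK.le ε₀ V,
            IsMinOn (fun W : GaugeField (F.P K) 0 (Matrix.specialUnitaryGroup (Fin 2) ℂ) => wilsonAction4 W) (regFibrePr F n K hnK.le ε₀ V) U →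
              RegPr F n K (max (B₃ * ε₁) (ε₀ / 2)) U) :
    ∀ L : ℕ, 1 < L → ∃ B₃ : ℝ, 4 < B₃ ∧ Prop8Printed B₃ (famX L) := by
  refine prop8_of_halvingNative fun L hL => ?_
  obtain ⟨B₃, hB₃, a₅, ha₅, h⟩ := H L hL
  exact ⟨B₃, hB₃, a₅, ha₅, halvingNative_of_minimisers h⟩

/-- **THE STUB-TO-STUB BRIDGE** a worker uses: the minimiser form at one `L` (for given `B₃`, `a₅`) gives the LITERAL one-step statement at that `L`
(the text of v7's `stub_halvingStep` under its `∃ B₃ ∃ a₅`). [cite: Balaban1985Variational, Sect. F p.304 before Prop. 8] -/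
theorem halvingLiteral_of_minimisers {L : ℕ} {a₅ B₃ : ℝ}
    (H : ∀ F : T3Family, F.L = L → ∀ (n K : ℕ) (hnK : n < K) (ε₀ ε₁ : ℝ), 0 < ε₁ → 0 < ε₀ → ε₀ ≤ a₅ →
      ∀ V : GaugeField (F.P n) 0 (Matrix.specialUnitaryGroup (Fin 2) ℂ), PlaqSmall ε₁ V →
        ∀ U ∈ regFibrePr F n K hnK.le ε₀ V,
          IsMinOn (fun W : GaugeField (F.P K) 0 (Matrix.specialUnitaryGroup (Fin 2) ℂ) => wilsonAction4 W) (regFibrePr F n K hnK.le ε₀ V) U →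
            RegPr F n K (max (B₃ * ε₁) (ε₀ / 2)) U) :
    ∀ (i : Idx L) (ε₀ ε₁ : ℝ), 0 < ε₁ → ∀ (V : (famX L i).Bdry) (U : (famX L i).Cfg), (famX L i).Reg7 ε₁ V → (famX L i).InU ε₀ U →
      (famX L i).InB V U → (famX L i).IsCritical V U → ε₀ ≤ a₅ → (famX L i).InU (max (B₃ * ε₁) (ε₀ / 2)) U :=
  halvingLiteral_iff_native.mpr (halvingNative_of_minimisers H)

end Summit.QuantumFields.YangMills.Theorems.Prop8Iter

end
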